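import Summits.QuantumFields.YangMills.Theorems.UnitScaleTiltProp8HalvingSliceMultiplier
import Summits.QuantumFields.YangMills.Theorems.UnitScaleTiltProp8HalvingSize152OfChart
import Summits.QuantumFields.YangMills.Theorems.UnitScaleTiltProp8HalvingA1Row165TraceAnyW
import HarnessLib

/-!
# Route `UnitScaleTilt`, crux K1 child «MinimiserStabilityRegPr» (stmt-QuantumFields-19200), registered stub V2′ `stub_halvingStep`
# (skeletons v8 5b4e846794b80374 ∕ v10 `BirthV10`) — **PILLAR P1 DISPLAYED: [B8] THEOREM 2 ON THE CUBE SEQUENCE AS ONE HYPOTHESIS, AND ITS KNIT INTO THE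
# (165)-A₁ ROW** (owner W-SEAT MAP #3 row M3 as reduced 03:35:33Z ∕ ASSIGNMENTS 9 (b) 05:01:42Z «(P1-disp) + knit»)

Cell `ym3-torus` (HUMAN RULING D-0037, YM ladder rung R3 — continuum SU(2) YM₃ on the torus is a RUNG, not the Clay problem), width seat
`ym-ust-19200-w7` gen 0 (D-0154 (3c)).  `--supports stmt-QuantumFields-19200 --as helper`; def-free, 0 sorry, standard axioms.

WHY.  The (165)-A₁ clause of the halving package (`HalvingAssemblyInterior.H_of_packageInt`, hypothesis `pkg`) is BY NAME
(✓ p603846 `HalvingA1Row165TraceAnyW.row165_of_tracePairing_L5_anyW`) from four displayed inputs on the chart field `A′`: (i) the trace pairing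
(✓ p605698 `HalvingDressedCriticality.tracePairing_of_isMinOn_dressed_wilson`, M2-a), (ii) the slice `∀ φ, R∂*(φ∘A′) = 0`, (iii) (98), (iv) the (152)
sizes `w₁‖A′‖ ≤ r`, `w₂L^{K−n}‖∇A′‖ ≤ r`.  Print obtains (ii) and (iv) from ONE source: [Balaban1985Variational] p. 301, *«Now we apply Theorem 2 of the
paper [6] to the pair of configurations U′_k, I … Then there exists a unique gauge transformation u satisfying the restrictions ū_j = 1 on Λ′_j and such
that U′_k^u = e^{iηA}, Lʲη|A|, (Lʲη)²|∇A|, … < 9dL²B₁Mε₀ on Ω′_j, j = 0, 1, …, k; (152)  Rd^{η*}A = 0 (153)»*, followed by p. 302 *«we make the change of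
variables A = A′ − HD(A′). The configuration A′ satisfies (152) with 36 instead of 9»* — the explicit preimage `A′ = A + H(C A)` of F4's `chart47W_range`
(✓ p606025 `HalvingSize152OfChart`, its `D(A′) = C(A)`).  THIS FILE states that source — pillar P1, «[B8] Thm 2 on the cube sequence `cubeSeqMT3`» — as
ONE displayed hypothesis in the assembler's letters (the package's (P1-chart) clause verbatim: `A` bondwise self-adjoint and `(u z)⁻¹·U⟨z,μ⟩·u(z+e_μ) =
expUnit(iηA⟨z,μ⟩)` on the layer; the (152) sizes of `A` in EXACTLY the shapes `hA₀`∕`hA₁` of `HalvingSize152OfChart.size152_bond`; the slice (153) of `A`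
in EXACTLY the matrix-multiplier shape of ✓ p604322 `HalvingSliceMultiplier.slice_of_matrixMultiplier`), and knits it into hypotheses (ii) and (iv) of
`row165_of_tracePairing_L5_anyW` for the SAME `A′ = A + H(C A)` on which M2-a supplies (i).

WHAT THIS FILE PROVES (no definition, no sorry; `H X := b ↦ Σ_c (flatH D e_c)(b)•X(c)` is the `ℂ`-linear kernel extension of P2's pinned `H`):
* §1 `kernelH`∕`kernelH_apply` (the kernel extension as a `ℂ`-linear map, built — not defined — for `size152_bond`), **`slice_of_chartPreimage`** (every
  `D : Domains (F.P K)`: the slice of `A` in reading form ⟹ the slice of `A + H X` for ANY index datum `X`, by ✓ `HalvingELJunction.slice_of_decomp` with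
  `𝔄 := H0`, `R := HX` — print p. 285 (45) «RD*HB = 0»), `slice_of_chartPreimage_of_multiplier` (the same from the matrix-multiplier form of (153)).
* §2 **`sliceAndSizes_of_P1rows`** (every `D`, any weights `w 1, w 2 ≥ 0`): the three P1 rows of `A` (slice in multiplier form, the two (152) sizes) and the
  rows of `H` (sup `B_H`, gradient `B_H′`) and of `C` ((44)-type quadratic letter `C₂` below `R`) ⟹ (ii) ∧ (iv) for `A′ = A + H(C A)`:
  `∀ φ, RE D L^{K−n}(dsE L^{K−n}(φ∘A′)) = 0`, `w 1 b‖A′ b‖ ≤ δ + B_H C₂δ²`, `w 2 b·L^{K−n}·‖A′⟨b₋+e_ν, dir b⟩ − A′ b‖ ≤ δ′ + B_H′C₂δ²`.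
* §3 **`package_rows_of_P1disp`** — AT THE CUBE SEQUENCE `D := cubeSeqMT3 F n K x ρ S M` with the level weights `IsLevWeight` of the F4 pen: from the ONE
  displayed hypothesis «P1 at the site `x`» (five conjuncts: self-adjointness, the chart identity on the `SideTouches` layer of the one-point top family at
  `x`, the two (152) sizes, the (153) multiplier form) and the `H`∕`C` rows: the package's (P1-chart) clause VERBATIM ∧ (ii) ∧ (iv) for `A′`.
HONEST SCOPE.  Bookkeeping over landed identities (`slice_of_decomp`, `slice_of_matrixMultiplier`, `size152_bond`); NO estimate and no analysis of [B8]
Theorem 2: the displayed hypothesis (pillar P1 — XL, the business of the Literature supplier: `B8Thm2SetupTorus`-type interfaces at the cube member),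
the gradient row of the chart-`H` ((X3′)) and `C`'s letter (P3a) are the consumer's.  NOT a claim about the stub, the crux, the rung or the mass gap.

References: T. Bałaban, CMP **102** (1985) 277–309 [Balaban1985Variational] (44)–(47) p.285, (59)–(62) p.287, (152)–(153) p.301, (157)–(159) pp.302–303,
(165) p.304; CMP **99** (1985) 75–102 [Balaban1985RegularSpaces] Thm 2 p.83, (1.36)–(1.38) p.82; CMP **96** (1984) 223–250 [Balaban1984PropagatorsII]
(2.12) p.225.
-/

set_option autoImplicit false

noncomputable section

open scoped BigOperators InnerProductSpace Matrix Matrix.Norms.L2Operator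

namespace Summit.QuantumFields.YangMills.Theorems.HalvingChartP1Display

open Literature.MathematicalPhysics.QuantumFieldTheory.Balaban1983to89
open Complex (I)
open B6SectADomainsV1 (Domains)
open B6SectAOperatorsV1 (BondIdx SiteIdx RE dsE)
open B7Prop1Explicit (expUnit)
open B8Eq140Level (SideTouches)
open B8Thm2SetupTorus (pullDom)
open B10Eq27TorusAxialLog (transl unitsField toUField)
open LatticeFieldCalculus (laplace diverg siteAvgIter)
open T3ContinuumYM3Torus (T3Family)
open FlatCubeOpsText (IsLevWeight)
open FlatOpsLettersAssembly (flatH levWeight_nonneg)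
open FlatCubeSequenceAligned (cubeSeqMT3)
open HalvingELJunction (slice_of_decomp)
open HalvingSliceMultiplier (slice_of_matrixMultiplier)
open HalvingSize152OfChart (size152_bond)

variable {F : T3Family} {n K : ℕ}

/-! ## §1 The kernel extension of `H` and the transport of the slice to the chart preimage -/

section Slice

/-- the `ℂ`-linear kernel extension `X ↦ (b ↦ Σ_c (flatH D e_c)(b)•X(c))` of P2's pinned `H` to `M₂(ℂ)`-valued index data (print's `H` acting on
`𝔤^ℂ`-valued configurations, p. 285 (45)–(46)), as a linear map — a local construction, no definition. [cite: Balaban1985Variational, (45)-(46) p.285] -/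
theorem kernelH_exists (D : Domains (F.P K)) :
    ∃ Hk : (BondIdx D → Matrix (Fin 2) (Fin 2) ℂ) →ₗ[ℂ] (PBond (F.P K) 0 → Matrix (Fin 2) (Fin 2) ℂ),
      ∀ X b, Hk X b = ∑ c, flatH F n K D (Pi.single c 1) b • X c :=
  ⟨LinearMap.pi fun b => ∑ c : BondIdx D, (flatH F n K D (Pi.single c 1) b : ℂ) • LinearMap.proj c, fun X b => by
    simp only [LinearMap.pi_apply, LinearMap.coe_sum, Finset.sum_apply, LinearMap.smul_apply, LinearMap.coe_proj, Function.eval,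
      Complex.coe_smul]⟩

/-- **THE SLICE PASSES TO THE CHART PREIMAGE**: if every reading of the Thm-2 log field `A` is on the slice (`R∂*(φ∘A) = 0`, (153) in P2's letters), then so is
every reading of `A + H X` for ANY `M₂(ℂ)`-valued index datum `X` — `R∂*H = 0` ((45) «RD*HB = 0»); in particular for print's `A′ = A + HD(A′)` of the change
of variables (47)∕(59). [cite: Balaban1985Variational, (45) p.285, (47) p.285, (59) p.287, (153) p.301] -/
theorem slice_of_chartPreimage (D : Domains (F.P K)) {A : PBond (F.P K) 0 → Matrix (Fin 2) (Fin 2) ℂ} (X : BondIdx D → Matrix (Fin 2) (Fin 2) ℂ)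
    (hA : ∀ φ : Matrix (Fin 2) (Fin 2) ℂ →ₗ[ℝ] ℝ,
      RE D ((F.L : ℝ) ^ (K - n)) (dsE ((F.L : ℝ) ^ (K - n)) (WithLp.toLp 2 (fun b => φ (A b)))) = 0) :
    ∀ φ : Matrix (Fin 2) (Fin 2) ℂ →ₗ[ℝ] ℝ,
      RE D ((F.L : ℝ) ^ (K - n)) (dsE ((F.L : ℝ) ^ (K - n))
        (WithLp.toLp 2 (fun b => φ ((A + fun b => ∑ c, flatH F n K D (Pi.single c 1) b • X c) b)))) = 0 :=
  slice_of_decomp D (A := A) (A₁ := A + fun b => ∑ c, flatH F n K D (Pi.single c 1) b • X c)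
    (𝔄 := fun b => ∑ c, flatH F n K D (Pi.single c 1) b • (0 : BondIdx D → Matrix (Fin 2) (Fin 2) ℂ) c)
    (R := fun b => ∑ c, flatH F n K D (Pi.single c 1) b • X c) (B := 0) (B' := X)
    (by
      funext b
      simp only [Pi.add_apply, Pi.sub_apply, Pi.zero_apply, smul_zero, Finset.sum_const_zero, add_zero, add_sub_cancel_right])
    (fun _ => rfl) (fun _ => rfl) hA

/-- the same from the MATRIX-MULTIPLIER FORM of (153) for `A` (`Δ(∂*A)(s) = Σ_i (Q′_{j(i)}e_s)(i)•μ(i)`, the input shape of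
`HalvingSliceMultiplier.slice_of_matrixMultiplier`). [cite: Balaban1985RegularSpaces, (1.38) p.82; Balaban1985Variational, (153) p.301] -/
theorem slice_of_chartPreimage_of_multiplier (D : Domains (F.P K)) {A : PBond (F.P K) 0 → Matrix (Fin 2) (Fin 2) ℂ}
    (X : BondIdx D → Matrix (Fin 2) (Fin 2) ℂ)
    (hμ : ∃ μ : SiteIdx D → Matrix (Fin 2) (Fin 2) ℂ, ∀ s : Site (F.P K) 0,
      laplace ((F.L : ℝ) ^ (K - n)) (diverg ((F.L : ℝ) ^ (K - n)) A) s = ∑ i : SiteIdx D, siteAvgIter (i.1.1 : ℕ) (Pi.single s (1 : ℝ)) i.1.2 • μ i) :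
    ∀ φ : Matrix (Fin 2) (Fin 2) ℂ →ₗ[ℝ] ℝ,
      RE D ((F.L : ℝ) ^ (K - n)) (dsE ((F.L : ℝ) ^ (K - n))
        (WithLp.toLp 2 (fun b => φ ((A + fun b => ∑ c, flatH F n K D (Pi.single c 1) b • X c) b)))) = 0 :=
  slice_of_chartPreimage D X (slice_of_matrixMultiplier D hμ)

end Slice

/-! ## §2 The three P1 rows of `A` and the rows of `H`, `C` give (ii) and (iv) for `A′ = A + H(C A)` -/

section Rows

/-- **(ii) AND (iv) OF THE (165)-A₁ ROW FROM THE P1 ROWS OF THE THM-2 LOG FIELD** (every nested family `D`, any weights `w 1, w 2 ≥ 0`, lattice factor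
`c = L^{K−n} = η⁻¹`): from the slice of `A` in multiplier form, its two (152) sizes `w 1 b‖A b‖ ≤ δ` (`δ < R`), `w 2 b·c·‖A⟨b₋+e_ν,dir b⟩ − A b‖ ≤ δ′`, the sup
row `B_H` and the gradient row `B_H′` of the kernel `H`, and the quadratic letter `C₂` of `C` below `R`: for `A′ = A + H(C A)` — the slice for every reading,
and both (152) letters `≤ δ + B_H C₂δ²`, `≤ δ′ + B_H′C₂δ²` (print (62) «< 2ε₂»; p. 302 «36 instead of 9»).
[cite: Balaban1985Variational, (44)-(46) p.285, (59)-(62) p.287, (152)-(153) p.301, p.302] -/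
theorem sliceAndSizes_of_P1rows (D : Domains (F.P K)) (w : ℕ → PBond (F.P K) 0 → ℝ) (hw1 : ∀ b, 0 ≤ w 1 b) (hw2 : ∀ b, 0 ≤ w 2 b)
    (C : (PBond (F.P K) 0 → Matrix (Fin 2) (Fin 2) ℂ) → (BondIdx D → Matrix (Fin 2) (Fin 2) ℂ)) {B_H B_H' C₂ R δ δ' : ℝ}
    (hH : ∀ (X : BondIdx D → Matrix (Fin 2) (Fin 2) ℂ) (t : ℝ), (∀ i, ‖X i‖ ≤ t) →
      ∀ b, w 1 b * ‖∑ c, flatH F n K D (Pi.single c 1) b • X c‖ ≤ B_H * t)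
    (hH' : ∀ (X : BondIdx D → Matrix (Fin 2) (Fin 2) ℂ) (t : ℝ), (∀ i, ‖X i‖ ≤ t) →
      ∀ (b : PBond (F.P K) 0) (ν : Fin (F.P K).d),
        w 2 b * (F.L : ℝ) ^ (K - n) * ‖(∑ c, flatH F n K D (Pi.single c 1) ⟨b.src.shift ν, b.dir⟩ • X c) - ∑ c, flatH F n K D (Pi.single c 1) b • X c‖ ≤ B_H' * t)
    (hCq : ∀ (Y : PBond (F.P K) 0 → Matrix (Fin 2) (Fin 2) ℂ) (r : ℝ), r < R → (∀ b, w 1 b * ‖Y b‖ ≤ r) → ∀ i, ‖C Y i‖ ≤ C₂ * r ^ 2)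
    {A : PBond (F.P K) 0 → Matrix (Fin 2) (Fin 2) ℂ}
    (hslice : ∃ μ : SiteIdx D → Matrix (Fin 2) (Fin 2) ℂ, ∀ s : Site (F.P K) 0,
      laplace ((F.L : ℝ) ^ (K - n)) (diverg ((F.L : ℝ) ^ (K - n)) A) s = ∑ i : SiteIdx D, siteAvgIter (i.1.1 : ℕ) (Pi.single s (1 : ℝ)) i.1.2 • μ i)
    (hδR : δ < R) (hA₀ : ∀ b, w 1 b * ‖A b‖ ≤ δ)
    (hA₁ : ∀ (b : PBond (F.P K) 0) (ν : Fin (F.P K).d), w 2 b * (F.L : ℝ) ^ (K - n) * ‖A ⟨b.src.shift ν, b.dir⟩ - A b‖ ≤ δ') :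
    (∀ φ : Matrix (Fin 2) (Fin 2) ℂ →ₗ[ℝ] ℝ,
      RE D ((F.L : ℝ) ^ (K - n)) (dsE ((F.L : ℝ) ^ (K - n))
        (WithLp.toLp 2 (fun b => φ ((A + fun b => ∑ c, flatH F n K D (Pi.single c 1) b • C A c) b)))) = 0) ∧
    (∀ b, w 1 b * ‖(A + fun b => ∑ c, flatH F n K D (Pi.single c 1) b • C A c) b‖ ≤ δ + B_H * (C₂ * δ ^ 2)) ∧
    (∀ (b : PBond (F.P K) 0) (ν : Fin (F.P K).d),
      w 2 b * (F.L : ℝ) ^ (K - n) *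
        ‖(A + fun b => ∑ c, flatH F n K D (Pi.single c 1) b • C A c) ⟨b.src.shift ν, b.dir⟩ -
          (A + fun b => ∑ c, flatH F n K D (Pi.single c 1) b • C A c) b‖ ≤ δ' + B_H' * (C₂ * δ ^ 2)) := by
  obtain ⟨Hk, hHk⟩ := kernelH_exists (F := F) (n := n) (K := K) D
  have hHkfun : ∀ X, Hk X = fun b => ∑ c, flatH F n K D (Pi.single c 1) b • X c := fun X => funext (hHk X)
  -- (iv): `size152_bond` for the kernel extension
  have hsz := size152_bond (P := F.P K) (β := BondIdx D) (V := Matrix (Fin 2) (Fin 2) ℂ) w ((F.L : ℝ) ^ (K - n)) hw1 hw2 (by positivity) Hk C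
    (B_H := B_H) (B_H' := B_H') (C₂ := C₂) (R := R) (δ := δ) (δ' := δ')
    (fun X t hX b => by rw [hHk]; exact hH X t hX b) (fun X t hX b ν => by rw [hHk, hHk]; exact hH' X t hX b ν) hCq A hδR hA₀ hA₁
  rw [hHkfun] at hsz
  exact ⟨slice_of_chartPreimage_of_multiplier D (C A) hslice, hsz.1, hsz.2⟩

end Rows

/-! ## §3 At the cube sequence: the package's (P1-chart) clause, (ii) and (iv) from ONE displayed P1 hypothesis -/

section CubeSeq

/-- **THE PACKAGE ROWS SERVED BY PILLAR P1, FROM ONE DISPLAYED HYPOTHESIS** — «[B8] Theorem 2 on the cube sequence `cubeSeqMT3 F n K x ρ S M` applied to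
the minimiser `U` at the site `x`» DISPLAYED as `hP1` (five conjuncts in the assembler's letters: `A` bondwise self-adjoint; the chart identity
`(u z)⁻¹·U⟨z,μ⟩·u(z+e_μ) = expUnit(iηA⟨z,μ⟩)` on the `SideTouches` layer of the one-point top family at `x` — the (P1-chart) clause of
`HalvingAssemblyInterior.H_of_packageInt` VERBATIM; the (152) sizes `w 1 b‖A b‖ ≤ δ`, `w 2 b·L^{K−n}‖A⟨b₋+e_ν,dir b⟩ − A b‖ ≤ δ′` at the level weights; the slice
(153) in matrix-multiplier form), plus the rows of `H` (sup, gradient) and of `C` (quadratic letter below `R > δ`): the (P1-chart) clause for `(u, A)`, and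
hypotheses (ii) (slice) and (iv) (both (152) letters, bounds `δ + B_H C₂δ²`, `δ′ + B_H′C₂δ²`) of `HalvingA1Row165TraceAnyW.row165_of_tracePairing_L5_anyW` for the
chart field `A′ = A + H(C A)` — the same `A′` at which `HalvingDressedCriticality.tracePairing_of_isMinOn_dressed_wilson` supplies (i).
[cite: Balaban1985RegularSpaces, Thm 2 p.83, (1.36)-(1.38) p.82; Balaban1985Variational, (152)-(153) p.301, (157)-(159) pp.302-303, (165) p.304] -/
theorem package_rows_of_P1disp (x : Site (F.P K) 0) (ρ S M : ℕ) (hM : 1 ≤ M) {w : ℕ → PBond (F.P K) 0 → ℝ}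
    (hw : IsLevWeight F n K (cubeSeqMT3 F n K x ρ S M hM) w)
    (C : (PBond (F.P K) 0 → Matrix (Fin 2) (Fin 2) ℂ) → (BondIdx (cubeSeqMT3 F n K x ρ S M hM) → Matrix (Fin 2) (Fin 2) ℂ)) {B_H B_H' C₂ R δ δ' : ℝ}
    (hH : ∀ (X : BondIdx (cubeSeqMT3 F n K x ρ S M hM) → Matrix (Fin 2) (Fin 2) ℂ) (t : ℝ), (∀ i, ‖X i‖ ≤ t) →
      ∀ b, w 1 b * ‖∑ c, flatH F n K (cubeSeqMT3 F n K x ρ S M hM) (Pi.single c 1) b • X c‖ ≤ B_H * t)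
    (hH' : ∀ (X : BondIdx (cubeSeqMT3 F n K x ρ S M hM) → Matrix (Fin 2) (Fin 2) ℂ) (t : ℝ), (∀ i, ‖X i‖ ≤ t) →
      ∀ (b : PBond (F.P K) 0) (ν : Fin (F.P K).d),
        w 2 b * (F.L : ℝ) ^ (K - n) *
          ‖(∑ c, flatH F n K (cubeSeqMT3 F n K x ρ S M hM) (Pi.single c 1) ⟨b.src.shift ν, b.dir⟩ • X c) -
            ∑ c, flatH F n K (cubeSeqMT3 F n K x ρ S M hM) (Pi.single c 1) b • X c‖ ≤ B_H' * t)
    (hCq : ∀ (Y : PBond (F.P K) 0 → Matrix (Fin 2) (Fin 2) ℂ) (r : ℝ), r < R → (∀ b, w 1 b * ‖Y b‖ ≤ r) → ∀ i, ‖C Y i‖ ≤ C₂ * r ^ 2)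
    (hδR : δ < R)
    (U : GaugeField (F.P K) 0 (Matrix.specialUnitaryGroup (Fin 2) ℂ))
    {u : GaugeTransf (F.P K) 0 (Matrix.unitaryGroup (Fin 2) ℂ)} {A : PBond (F.P K) 0 → Matrix (Fin 2) (Fin 2) ℂ}
    (hP1 : (∀ b : PBond (F.P K) 0, IsSelfAdjoint (A b)) ∧
      (∀ (z : B7Prop1Explicit.Site (F.P K).d) (μ : Fin (F.P K).d),
        SideTouches (pullDom (fun j => if K - n ≤ j then ({x} : Set (Site (F.P K) 0)) else (∅ : Set (Site (F.P K) 0))) (K - n)) z μ →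
        (Unitary.toUnits (u (transl 0 z)))⁻¹ * unitsField (toUField U) ⟨transl 0 z, μ⟩ * Unitary.toUnits (u ((transl 0 z).shift μ)) =
          expUnit (I • ((((F.L : ℝ)⁻¹) ^ (K - n)) • A ⟨transl 0 z, μ⟩))) ∧
      (∀ b, w 1 b * ‖A b‖ ≤ δ) ∧
      (∀ (b : PBond (F.P K) 0) (ν : Fin (F.P K).d), w 2 b * (F.L : ℝ) ^ (K - n) * ‖A ⟨b.src.shift ν, b.dir⟩ - A b‖ ≤ δ') ∧
      (∃ μ : SiteIdx (cubeSeqMT3 F n K x ρ S M hM) → Matrix (Fin 2) (Fin 2) ℂ, ∀ s : Site (F.P K) 0,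
        laplace ((F.L : ℝ) ^ (K - n)) (diverg ((F.L : ℝ) ^ (K - n)) A) s =
          ∑ i : SiteIdx (cubeSeqMT3 F n K x ρ S M hM), siteAvgIter (i.1.1 : ℕ) (Pi.single s (1 : ℝ)) i.1.2 • μ i)) :
    ((∀ b : PBond (F.P K) 0, IsSelfAdjoint (A b)) ∧
      (∀ (z : B7Prop1Explicit.Site (F.P K).d) (μ : Fin (F.P K).d),
        SideTouches (pullDom (fun j => if K - n ≤ j then ({x} : Set (Site (F.P K) 0)) else (∅ : Set (Site (F.P K) 0))) (K - n)) z μ →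
        (Unitary.toUnits (u (transl 0 z)))⁻¹ * unitsField (toUField U) ⟨transl 0 z, μ⟩ * Unitary.toUnits (u ((transl 0 z).shift μ)) =
          expUnit (I • ((((F.L : ℝ)⁻¹) ^ (K - n)) • A ⟨transl 0 z, μ⟩)))) ∧
    (∀ φ : Matrix (Fin 2) (Fin 2) ℂ →ₗ[ℝ] ℝ,
      RE (cubeSeqMT3 F n K x ρ S M hM) ((F.L : ℝ) ^ (K - n)) (dsE ((F.L : ℝ) ^ (K - n))
        (WithLp.toLp 2 (fun b => φ ((A + fun b => ∑ c, flatH F n K (cubeSeqMT3 F n K x ρ S M hM) (Pi.single c 1) b • C A c) b)))) = 0) ∧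
    (∀ b, w 1 b * ‖(A + fun b => ∑ c, flatH F n K (cubeSeqMT3 F n K x ρ S M hM) (Pi.single c 1) b • C A c) b‖ ≤ δ + B_H * (C₂ * δ ^ 2)) ∧
    (∀ (b : PBond (F.P K) 0) (ν : Fin (F.P K).d),
      w 2 b * (F.L : ℝ) ^ (K - n) *
        ‖(A + fun b => ∑ c, flatH F n K (cubeSeqMT3 F n K x ρ S M hM) (Pi.single c 1) b • C A c) ⟨b.src.shift ν, b.dir⟩ -
          (A + fun b => ∑ c, flatH F n K (cubeSeqMT3 F n K x ρ S M hM) (Pi.single c 1) b • C A c) b‖ ≤ δ' + B_H' * (C₂ * δ ^ 2)) := by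
  obtain ⟨hsa, hchart, hA₀, hA₁, hslice⟩ := hP1
  have h := sliceAndSizes_of_P1rows (cubeSeqMT3 F n K x ρ S M hM) w (levWeight_nonneg hw 1) (levWeight_nonneg hw 2) C hH hH' hCq hslice hδR hA₀ hA₁
  exact ⟨⟨hsa, hchart⟩, h.1, h.2.1, h.2.2⟩

end CubeSeq

/-! ## §4 The 𝔰𝔲(2) reading: tracelessness passes to the chart preimage (v1.1, append-only; owner RULING g26-№3)

The (165)-A₁ row of record is now `HalvingA1Row165TraceSU2.row165_of_tracePairing_L5_su2` (✓ p609981), which asks the chart field `A′` to be bondwise TRACELESS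
(𝔰𝔲(2)-valued).  `A′ = A + H(C A)` is traceless as soon as the Thm-2 log field `A` is (the `mlog` of `SU(2)` data near `1`:
`Literature…B15SU2ChartHolomorphic.trace_mlog_eq_zero`) and the chart remainder `C A` is (a displayed row on P3a's `C`): the kernel `H` acts componentwise with REAL
coefficients `(flatH D e_c)(b)`. -/

section SU2

/-- **THE KERNEL EXTENSION PRESERVES TRACELESSNESS**: `tr(Σ_c (flatH D e_c)(b)•X(c)) = 0` when every `X(c)` is traceless. [cite: Balaban1985Variational, (45)-(46) p.285] -/
theorem trace_kernelH_eq_zero (D : Domains (F.P K)) {X : BondIdx D → Matrix (Fin 2) (Fin 2) ℂ} (hX : ∀ c, Matrix.trace (X c) = 0)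
    (b : PBond (F.P K) 0) : Matrix.trace (∑ c, flatH F n K D (Pi.single c 1) b • X c) = 0 := by
  rw [Matrix.trace_sum]
  refine Finset.sum_eq_zero fun c _ => ?_
  rw [Matrix.trace_smul, hX c, smul_zero]

/-- **THE CHART PREIMAGE OF 𝔰𝔲(2) DATA IS 𝔰𝔲(2)-VALUED**: `A` bondwise traceless and `X` traceless ⟹ `A + H X` bondwise traceless; in particular for print's
`A′ = A + HD(A′)` (`X = C A`). [cite: Balaban1985Variational, (47) p.285, (59) p.287, (152) p.301] -/
theorem trace_chartPreimage_eq_zero (D : Domains (F.P K)) {A : PBond (F.P K) 0 → Matrix (Fin 2) (Fin 2) ℂ} {X : BondIdx D → Matrix (Fin 2) (Fin 2) ℂ}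
    (hA : ∀ b, Matrix.trace (A b) = 0) (hX : ∀ c, Matrix.trace (X c) = 0) :
    ∀ b, Matrix.trace ((A + fun b => ∑ c, flatH F n K D (Pi.single c 1) b • X c) b) = 0 := by
  intro b
  rw [Pi.add_apply, Matrix.trace_add, hA b, trace_kernelH_eq_zero D hX b, add_zero]

/-- ★★ **THE PACKAGE ROWS SERVED BY PILLAR P1 IN THE 𝔰𝔲(2) READING** — `package_rows_of_P1disp` with the displayed P1 hypothesis carrying the SIXTH conjunct «`A` bondwise
traceless» (second position) and the displayed row `hCtr` «the chart remainder of traceless data is traceless» on `C`; outputs in addition `∀ b, tr A′(b) = 0` — the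
`hA′tr` binder of `HalvingA1Row165TraceSU2.row165_of_tracePairing_L5_su2` — for the same `A′ = A + H(C A)`.
[cite: Balaban1985RegularSpaces, Thm 2 p.83, (1.36)-(1.38) p.82; Balaban1985Variational, (152)-(153) p.301, (157)-(159) pp.302-303, (165) p.304] -/
theorem package_rows_of_P1disp_su2 (x : Site (F.P K) 0) (ρ S M : ℕ) (hM : 1 ≤ M) {w : ℕ → PBond (F.P K) 0 → ℝ}
    (hw : IsLevWeight F n K (cubeSeqMT3 F n K x ρ S M hM) w)
    (C : (PBond (F.P K) 0 → Matrix (Fin 2) (Fin 2) ℂ) → (BondIdx (cubeSeqMT3 F n K x ρ S M hM) → Matrix (Fin 2) (Fin 2) ℂ)) {B_H B_H' C₂ R δ δ' : ℝ}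
    (hH : ∀ (X : BondIdx (cubeSeqMT3 F n K x ρ S M hM) → Matrix (Fin 2) (Fin 2) ℂ) (t : ℝ), (∀ i, ‖X i‖ ≤ t) →
      ∀ b, w 1 b * ‖∑ c, flatH F n K (cubeSeqMT3 F n K x ρ S M hM) (Pi.single c 1) b • X c‖ ≤ B_H * t)
    (hH' : ∀ (X : BondIdx (cubeSeqMT3 F n K x ρ S M hM) → Matrix (Fin 2) (Fin 2) ℂ) (t : ℝ), (∀ i, ‖X i‖ ≤ t) →
      ∀ (b : PBond (F.P K) 0) (ν : Fin (F.P K).d),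
        w 2 b * (F.L : ℝ) ^ (K - n) *
          ‖(∑ c, flatH F n K (cubeSeqMT3 F n K x ρ S M hM) (Pi.single c 1) ⟨b.src.shift ν, b.dir⟩ • X c) -
            ∑ c, flatH F n K (cubeSeqMT3 F n K x ρ S M hM) (Pi.single c 1) b • X c‖ ≤ B_H' * t)
    (hCq : ∀ (Y : PBond (F.P K) 0 → Matrix (Fin 2) (Fin 2) ℂ) (r : ℝ), r < R → (∀ b, w 1 b * ‖Y b‖ ≤ r) → ∀ i, ‖C Y i‖ ≤ C₂ * r ^ 2)
    (hCtr : ∀ (Y : PBond (F.P K) 0 → Matrix (Fin 2) (Fin 2) ℂ), (∀ b, Matrix.trace (Y b) = 0) → ∀ i, Matrix.trace (C Y i) = 0)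
    (hδR : δ < R)
    (U : GaugeField (F.P K) 0 (Matrix.specialUnitaryGroup (Fin 2) ℂ))
    {u : GaugeTransf (F.P K) 0 (Matrix.unitaryGroup (Fin 2) ℂ)} {A : PBond (F.P K) 0 → Matrix (Fin 2) (Fin 2) ℂ}
    (hP1 : (∀ b : PBond (F.P K) 0, IsSelfAdjoint (A b)) ∧ (∀ b : PBond (F.P K) 0, Matrix.trace (A b) = 0) ∧
      (∀ (z : B7Prop1Explicit.Site (F.P K).d) (μ : Fin (F.P K).d),
        SideTouches (pullDom (fun j => if K - n ≤ j then ({x} : Set (Site (F.P K) 0)) else (∅ : Set (Site (F.P K) 0))) (K - n)) z μ →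
        (Unitary.toUnits (u (transl 0 z)))⁻¹ * unitsField (toUField U) ⟨transl 0 z, μ⟩ * Unitary.toUnits (u ((transl 0 z).shift μ)) =
          expUnit (I • ((((F.L : ℝ)⁻¹) ^ (K - n)) • A ⟨transl 0 z, μ⟩))) ∧
      (∀ b, w 1 b * ‖A b‖ ≤ δ) ∧
      (∀ (b : PBond (F.P K) 0) (ν : Fin (F.P K).d), w 2 b * (F.L : ℝ) ^ (K - n) * ‖A ⟨b.src.shift ν, b.dir⟩ - A b‖ ≤ δ') ∧
      (∃ μ : SiteIdx (cubeSeqMT3 F n K x ρ S M hM) → Matrix (Fin 2) (Fin 2) ℂ, ∀ s : Site (F.P K) 0,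
        laplace ((F.L : ℝ) ^ (K - n)) (diverg ((F.L : ℝ) ^ (K - n)) A) s =
          ∑ i : SiteIdx (cubeSeqMT3 F n K x ρ S M hM), siteAvgIter (i.1.1 : ℕ) (Pi.single s (1 : ℝ)) i.1.2 • μ i)) :
    ((∀ b : PBond (F.P K) 0, IsSelfAdjoint (A b)) ∧
      (∀ (z : B7Prop1Explicit.Site (F.P K).d) (μ : Fin (F.P K).d),
        SideTouches (pullDom (fun j => if K - n ≤ j then ({x} : Set (Site (F.P K) 0)) else (∅ : Set (Site (F.P K) 0))) (K - n)) z μ →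
        (Unitary.toUnits (u (transl 0 z)))⁻¹ * unitsField (toUField U) ⟨transl 0 z, μ⟩ * Unitary.toUnits (u ((transl 0 z).shift μ)) =
          expUnit (I • ((((F.L : ℝ)⁻¹) ^ (K - n)) • A ⟨transl 0 z, μ⟩)))) ∧
    (∀ b, Matrix.trace ((A + fun b => ∑ c, flatH F n K (cubeSeqMT3 F n K x ρ S M hM) (Pi.single c 1) b • C A c) b) = 0) ∧
    (∀ φ : Matrix (Fin 2) (Fin 2) ℂ →ₗ[ℝ] ℝ,
      RE (cubeSeqMT3 F n K x ρ S M hM) ((F.L : ℝ) ^ (K - n)) (dsE ((F.L : ℝ) ^ (K - n))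
        (WithLp.toLp 2 (fun b => φ ((A + fun b => ∑ c, flatH F n K (cubeSeqMT3 F n K x ρ S M hM) (Pi.single c 1) b • C A c) b)))) = 0) ∧
    (∀ b, w 1 b * ‖(A + fun b => ∑ c, flatH F n K (cubeSeqMT3 F n K x ρ S M hM) (Pi.single c 1) b • C A c) b‖ ≤ δ + B_H * (C₂ * δ ^ 2)) ∧
    (∀ (b : PBond (F.P K) 0) (ν : Fin (F.P K).d),
      w 2 b * (F.L : ℝ) ^ (K - n) *
        ‖(A + fun b => ∑ c, flatH F n K (cubeSeqMT3 F n K x ρ S M hM) (Pi.single c 1) b • C A c) ⟨b.src.shift ν, b.dir⟩ -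
          (A + fun b => ∑ c, flatH F n K (cubeSeqMT3 F n K x ρ S M hM) (Pi.single c 1) b • C A c) b‖ ≤ δ' + B_H' * (C₂ * δ ^ 2)) := by
  obtain ⟨hsa, htr, hchart, hA₀, hA₁, hslice⟩ := hP1
  obtain ⟨h0, h1, h2, h3⟩ := package_rows_of_P1disp x ρ S M hM hw C hH hH' hCq hδR U ⟨hsa, hchart, hA₀, hA₁, hslice⟩
  exact ⟨h0, trace_chartPreimage_eq_zero _ htr (hCtr A htr), h1, h2, h3⟩

end SU2

end Summit.QuantumFields.YangMills.Theorems.HalvingChartP1Display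

end
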